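import Summits.BirchSwinnertonDyer.Rank1Residual.X1.GeneratorCountLayerAtV0
import Summits.BirchSwinnertonDyer.Rank1Residual.X1.LayerFixedPointsCount
import Summits.BirchSwinnertonDyer.Rank1Residual.X1.StrictAtPOfInertiaTransported
import Summits.BirchSwinnertonDyer.Rank1Residual.X1.LocalKerOverAtPConj
import HarnessLib

/-!
# Route M's generator COUNT at LAYER `n`, VIII: ROUTE R1′ ASSEMBLED — the layer-`n` count over `ℚ_n`
# with the local term at the prime above `p` imposed by STRICTNESS AT `p` OVER `ℚ_∞`
# (cell `b2b-bsdres`, unit `b2b-bsdres-eisenstein-p1`, gen 19; X1R0-GAPMAP §28, memo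
# `V76-LOCAL-TERM-PLAN.md` §4.5)

HONEST FRAMING (run/shared/lean/b2b/bsd-rank1-residual/, verbatim in every file): the goal of the
cell is to DELETE the COMBINATION-SHAPED residual classes of the Birch–Swinnerton-Dyer formula for
ALL analytic-rank `≤ 1` elliptic curves over `ℚ` — "full BSD formula for every rank `≤ 1` curve in
class `C`" assembled STRICTLY from published theorems — so that the rank-`≤ 1` remainder becomes
exactly the CONSTRUCTION-SHAPED classes, which are TYPED (missing-input `Prop`s), NOT attempted.
This is not "finishing BSD". Sub-cell `b2b-bsdres-eisenstein-p1` (CLASS-OWNERS row "X1 (r = 0)"):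
research route; NO CLAIM BEYOND STATED CLASSES; nothing here changes a label; nothing is booked.
THEOREMS ONLY — no definition, no named fact, no typed input introduced; the local data at the prime
`wp` of `ℚ_n` above `p` (`𝓛`, its index `p^e`, strictness of its classes), the Poitou–Tate family,
the local Euler–Poincaré formula and Greenberg's Prop. 2.4 (`hGrK`, published, typed
`imKummer_ge_strictCondition_goodOrdinary`) are HYPOTHESES; nothing about any particular curve asserted.

## What and why

Over `ℚ`, `κ` the cyclotomic `ℤ_p`-extension, `E` globally minimal, `p` odd good ordinary at `v ∋ p`,
`wp` a prime of `ℚ_n` above `v`: FILE 9 §3's layer-`n` count `#T₀ + a ≤ λ(X) + pⁿ μ(X)`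
(`X1/GeneratorCountLayerAtP.succ_card_le_lambda_add_pow_mul_mu_of_tamagawaWitnesses_layer_at`) with
its `ℚ_{n,∞}`-framework hypothesis `hloc` at `wp` — which the ℚ-typed Prop. 2.4 does not deliver —
REPLACED by STRICTNESS AT `p` OVER `ℚ_∞`: every class `y ∈ H¹(ℚ_n, E[p])` with `res_wp y ∈ 𝓛_wp` has
a cocycle `φ` with `red_v(β⁻¹ φ(x)) = Õ` for all `x ∈ I_v ∩ Gal(ℚ̄/ℚ_∞)` (`hstrict`), and the index
`p · #𝓚 ≤ #𝓛` generalised to `p^e · #𝓚 ≤ #𝓛`. Chain: FILE 21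
`StrictAtPOfInertiaTransported.kerH1Iso_layerToInfty_mem_localKerOver` (Prop. 2.4 BY NAME: the
transported class is Kummer over `ℚ_∞` at the chosen place above `p`) → FILE 22
`LocalKerOverAtPConj.conjH1_mem_localKerOver_of_mem` (ONE place of `ℚ_∞` above `p`: all conjugates)
= §1 `conjH1_kerH1Iso_layerToInfty_mem_localKerOver_of_strict`, the `K_∞`-level hypothesis `hv₀`
of the K-general counts `X1/GeneratorCountLayerAtV0` / `X1/LayerFixedPointsCount` (`RelaxedKummerCountPow`
→ `LayerClassesToSelmerInfty` / `GeneratorCountLayerLocal` → FILE 5), which live in the import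
context of FILES 6–9 (the `ℚ_n`-level types are only passed through here; X1R0-GAPMAP §27.3).
Three forms (§2):

* `pow_card_add_le_natCard_quotient_layerIdeal_mul_sq_of_strict` (ANY `E(ℚ)[p]`; the finiteness of
  `E(ℚ_∞)[p^∞]` as the hypothesis `hfix` — over `ℚ` at `p` odd good ordinary it is the tree's
  `finite_fixedPoints_kerSubgroup_geomPrimaryTorsion_of_ordinary`):
  **`p^{#T₀ + e} ≤ #(X/I_nX) · #{b ∈ E[p^∞] | Gal(ℚ̄/ℚ_n)·b = b}²`**;
* `pow_card_add_le_pow_mul_sq_of_strict`: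
  **`p^{#T₀ + e} ≤ p^{λ + pⁿμ} · #{b ∈ E[p^∞] | Gal(ℚ̄/ℚ_n)·b = b}²`** (X1R0-GAPMAP §14.1's
  `t_n + a − 2δ ≤ λ + pⁿμ` with `a = e`; over `ℚ` at good ordinary odd `p`,
  `E[p^∞]^{Gal(ℚ̄/ℚ_n)} = E(ℚ)[p^∞]`);
* `card_add_le_lambda_add_pow_mul_mu_of_strict` (`E(ℚ)[p] = 0`): **`#T₀ + e ≤ λ + pⁿμ`**.
* §3 `pow_card_add_le_pow_mul_sq_of_strict_of_ordinary` (good ordinary odd `p`): the finiteness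
  DISCHARGED (tree `finite_fixedPoints_kerSubgroup_geomPrimaryTorsion_of_ordinary`) and the loss
  factor `= #E[p^∞]^{Γ_ℚ}` (`= #E(ℚ)[p^∞]`, tree `natCard_fixedBy_layerSubgroup_eq_of_ordinary`):
  **`p^{#T₀ + e} ≤ p^{λ + pⁿμ} · (#E[p^∞]^{Γ_ℚ})²`**.

So "(M1-a) disappears" (memo §4.5) is now a kernel fact: what remains of (M1) for the 11 layer-1
classes (X1R0-GAPMAP §27.3) is LOCAL at `wp` — a subgroup `𝓛_wp ⊇ 𝓚_wp` of `H¹((ℚ_n)_wp, E[p])` with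
`p²·#𝓚_wp ≤ #𝓛_wp` all of whose classes are strict in the above sense (memo §4.10: `𝓛_wp` =
vanishing of `red ∘ φ` on `I_{ℚ_p} ∩ G_{ℚ_{p,∞}}`, index `p²` when `E(ℚ_p)[p] ≠ 0`) — X1R0-GAPMAP §28.

References: [GreenbergLNM1716] §2 Prop. 2.4, §3 Lemma 3.1, Lemma 3.4, §5 pp. 114–118, p. 137;
[MilneADT2006] Ch. I Thm. 2.8, Thm. 4.10; [SerreLocalFields1979] IV §4 Prop. 17; X1R0-GAPMAP
§14.1, §26–§28.
-/

noncomputable section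

open scoped Classical

open Function Field NumberField IsDedekindDomain WeierstrassCurve PowerSeries
  Literature.NumberTheory.EllipticCurves Literature.NumberTheory.GaloisRepresentations
  Literature.NumberTheory.GaloisCohomology Summit.BirchSwinnertonDyer.Rank1Residual.GaloisImage
  Literature.NumberTheory.EllipticCurves.IwasawaAlgebra
  Summit.BirchSwinnertonDyer.Rank1Residual.Additive
  Summit.BirchSwinnertonDyer.Rank1Residual.Additive.ZpTower
  Summit.BirchSwinnertonDyer.Rank1Residual.X1.GeneratorBoundMuLayer
open Literature.NumberTheory.GaloisRepresentations.DiscreteGaloisModule (SelmerStructure unramifiedSubgroup)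
open Literature.NumberTheory.EllipticCurves.Greenberg1999 (imKummer_ge_strictCondition_goodOrdinary)
open Literature.NumberTheory.EllipticCurves.GreenbergSelmer (inertiaIn inertiaInToH)
open Summit.BirchSwinnertonDyer.Rank1Residual.X2.GreenbergVatsalReductionDatum (localRed)

set_option autoImplicit false

namespace Summit.BirchSwinnertonDyer.Rank1Residual.X1.GeneratorCountLayerAtPStrict

variable (W : WeierstrassCurve ℚ) [W.IsElliptic] [W.IsGloballyMinimal] {p : ℕ} [hp : Fact p.Prime]
  (κ : ZpExtension ℚ p) (n : ℕ) (κn : ZpExtension (κ.layer n) p)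
  (hκn : ∀ σ : Field.absoluteGaloisGroup (κ.layer n),
    (κn σ).toAdd * (p : ℤ_[p]) ^ n = (κ (resGal (K := ℚ) (κ.layer n) σ)).toAdd)

/-! ## §1. Strictness at `p` gives the `ℚ_∞`-condition at `p` for all conjugates -/

/-- **A class over `ℚ_n` strict at `p` has ALL conjugates of its transport Kummer over `ℚ_∞` at the
place above `p`**: FILE 21 (`kerH1Iso_layerToInfty_mem_localKerOver`, Prop. 2.4 by name) + FILE 22
(`conjH1_mem_localKerOver_of_mem`, `Γ_ℚ = res(I_{ℚ_v})·ker κ`).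
[cite: GreenbergLNM1716, §2 Prop. 2.4] [cite: SerreLocalFields1979, Ch. IV §4 Prop. 17] -/
theorem conjH1_kerH1Iso_layerToInfty_mem_localKerOver_of_strict
    (hGrK : imKummer_ge_strictCondition_goodOrdinary)
    (hΔ : ¬ (p : ℤ) ∣ minimalDiscriminantInt W) (hord : ¬ (p : ℤ) ∣ W.frobeniusTrace p)
    (hκ : κ.IsCyclotomic) (v : HeightOneSpectrum (𝓞 ℚ)) (hpv : ((p : ℕ) : 𝓞 ℚ) ∈ v.asIdeal)
    (φ : contOneCocycles (discreteTopRep (Field.absoluteGaloisGroup (κ.layer n))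
      (geomTorsion (W.baseChange (κ.layer n)) (p : ℤ))))
    (hφ : ∀ x : inertiaIn κ.kerSubgroup v,
      localRed W p hpv hΔ (pointsMap W (v.adicCompletion ℚ)
        (((primaryBaseChangeEquiv (κ.layer n) W p).symm
          (AddSubgroup.inclusion (geomTorsion_le_geomPrimaryTorsion (W.baseChange (κ.layer n)) p)
            (φ.1 ((kerOfKer κ n κn hκn (inertiaInToH κ.kerSubgroup v x) : κn.kerSubgroup) :
              Field.absoluteGaloisGroup (κ.layer n)))) : W.geomPrimaryTorsion p) : W.geomPoints)) = 0)
    (σ : Field.absoluteGaloisGroup ℚ) :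
    W.conjH1 p κ.kerSubgroup σ (kerH1Iso W κ n κn hκn ((W.baseChange (κ.layer n)).layerToInfty κn 0
      (resH1Hom (Literature.NumberTheory.EllipticCurves.subgroupIncl (κn.layerSubgroup 0))
        (AddMonoidHom.id (geomPrimaryTorsion (W.baseChange (κ.layer n)) p)) (fun _ _ ↦ rfl)
        (torsionToPrimaryH1 (W.baseChange (κ.layer n)) p (oneCocycleClass _ φ))))) ∈
      W.localKerOver p κ.kerSubgroup (v.adicCompletion ℚ) :=
  LocalKerOverAtPConj.conjH1_mem_localKerOver_of_mem p κ W hκ hpv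
    (StrictAtPOfInertiaTransported.kerH1Iso_layerToInfty_mem_localKerOver W κ n κn hκn hGrK hΔ hord hκ
      v hpv φ hφ) σ

/-! ## §2. Route R1′ assembled over `ℚ_n` -/

section Rat

variable {γ : Field.absoluteGaloisGroup ℚ} (D : W.SelmerDualData κ γ)

include hκn

/-- **ROUTE R1′, LOSSY FORM (any `E(ℚ)[p]`)**: `p^{#T₀ + e} ≤ #(X/I_nX) · #{b ∈ E[p^∞] | Gal(ℚ̄/ℚ_n)·b = b}²`.
`E/ℚ` globally minimal, `p` odd, `p ∤ Δ_E`, `p ∤ a_p`, `κ` cyclotomic with layer `ℚ_n` and restricted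
tower `κ_n`, `{b ∈ E[p^∞] | Gal(ℚ̄/ℚ_∞)·b = b}` finite (`hfix`), `v ∋ p` and `wp` a prime of `ℚ_n` above
`v`, `D` any dual datum of `Sel_{p^∞}(E/ℚ_∞)` (`X` f.g.); a Poitou–Tate family and the local
Euler–Poincaré formula over `ℚ_n`; `T₀` places `w ∤ p` of `ℚ_n` with Tamagawa witnesses; at `wp` a
local condition `𝓛 ⊇ 𝓚` of index `≥ p^e` whose classes are STRICT at `p` (`hstrict`); Greenberg's
Prop. 2.4 BY NAME (`hGrK`).
[cite: GreenbergLNM1716, §2 Prop. 2.4, §3 Lemma 3.1, Lemma 3.4, §5 pp. 114–118] -/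
theorem pow_card_add_le_natCard_quotient_layerIdeal_mul_sq_of_strict
    [Module.Finite (IwasawaAlgebra p) D.X] [NumberField (κ.layer n)]
    (hfix : Set.Finite {b : geomPrimaryTorsion W p |
      ∀ τ : Field.absoluteGaloisGroup ℚ, τ ∈ κ.kerSubgroup → τ • b = b})
    (hodd : p ≠ 2) (hκ : κ.IsCyclotomic) (hGrK : imKummer_ge_strictCondition_goodOrdinary)
    (v : HeightOneSpectrum (𝓞 ℚ)) (hpv : ((p : ℕ) : 𝓞 ℚ) ∈ v.asIdeal)
    (hΔ : ¬ (p : ℤ) ∣ minimalDiscriminantInt W) (hord : ¬ (p : ℤ) ∣ W.frobeniusTrace p)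
    (inv : LocalInvariants (κ.layer n) p) (hperf : inv.IsPerfect) (hsum : inv.SumLocalTermEqZero)
    (hcompl : inv.SelmerComplement)
    (hEP : ∀ w : HeightOneSpectrum (𝓞 (κ.layer n)),
      localEulerPoincareCharacteristic (w.adicCompletion (κ.layer n)))
    (T₀ : Finset (HeightOneSpectrum (𝓞 (κ.layer n))))
    (hT₀p : ∀ w ∈ T₀, ((p : ℕ) : 𝓞 (κ.layer n)) ∉ w.asIdeal)
    (hwit : ∀ w ∈ T₀, ∃ u ∈ unramifiedSubgroup
        (((W.baseChange (κ.layer n)).torsionGaloisModule (p : ℤ)).restrictField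
          (w.adicCompletion (κ.layer n))) 1,
      u ∉ (W.baseChange (κ.layer n)).kummerLocalConditionAt (p : ℤ) (w.adicCompletion (κ.layer n)))
    (wp : HeightOneSpectrum (𝓞 (κ.layer n))) (hwpT₀ : wp ∉ T₀) (hwpv : wp.asIdeal.LiesOver v.asIdeal)
    (𝓛 : ∀ w : HeightOneSpectrum (𝓞 (κ.layer n)), AddSubgroup (galoisCohomology
      (((W.baseChange (κ.layer n)).torsionGaloisModule (p : ℤ)).toLocal (Sum.inr w)) 1))
    (h𝓛 : (W.baseChange (κ.layer n)).kummerSelmerStructure (p : ℤ) (Sum.inr wp) ≤ 𝓛 wp) (e : ℕ)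
    (hidx : p ^ e * Nat.card ((W.baseChange (κ.layer n)).kummerSelmerStructure (p : ℤ) (Sum.inr wp)) ≤
      Nat.card (𝓛 wp))
    (hstrict : ∀ y : galH1Torsion (W.baseChange (κ.layer n)) (p : ℤ),
      galoisCohomology.localization ((W.baseChange (κ.layer n)).torsionGaloisModule (p : ℤ))
        (Sum.inr wp) 1 y ∈ 𝓛 wp →
      ∃ φ : contOneCocycles (discreteTopRep (Field.absoluteGaloisGroup (κ.layer n))
        (geomTorsion (W.baseChange (κ.layer n)) (p : ℤ))), oneCocycleClass _ φ = y ∧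
        ∀ x : inertiaIn κ.kerSubgroup v,
          localRed W p hpv hΔ (pointsMap W (v.adicCompletion ℚ)
            (((primaryBaseChangeEquiv (κ.layer n) W p).symm
              (AddSubgroup.inclusion (geomTorsion_le_geomPrimaryTorsion (W.baseChange (κ.layer n)) p)
                (φ.1 ((kerOfKer κ n κn hκn (inertiaInToH κ.kerSubgroup v x) : κn.kerSubgroup) :
                  Field.absoluteGaloisGroup (κ.layer n)))) : W.geomPrimaryTorsion p) :
              W.geomPoints)) = 0) :
    p ^ (T₀.card + e) ≤ Nat.card (D.X ⧸ Ideal.span {(C (p : ℤ_[p]) : IwasawaAlgebra p),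
        (1 + (X : IwasawaAlgebra p)) ^ p ^ n - 1} • (⊤ : Submodule (IwasawaAlgebra p) D.X)) *
      Nat.card {b : geomPrimaryTorsion W p //
        ∀ σ : Field.absoluteGaloisGroup ℚ, σ ∈ κ.layerSubgroup n → σ • b = b} ^ 2 :=
  LayerFixedPointsCount.pow_card_add_le_natCard_quotient_layerIdeal_mul_sq' n κn hκn D hfix hodd hκ
    inv hperf hsum hcompl hEP T₀ hT₀p hwit v wp hwpT₀ hwpv 𝓛 h𝓛 e hidx
    (fun y hy σ ↦ by
      obtain ⟨φ, rfl, hφ⟩ := hstrict y hy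
      exact conjH1_kerH1Iso_layerToInfty_mem_localKerOver_of_strict W κ n κn hκn hGrK hΔ hord hκ v hpv
        φ hφ σ)

/-- **ROUTE R1′, LOSSY FORM in `λ`, `μ`**:
`p^{#T₀ + e} ≤ p^{λ(X) + pⁿμ(X)} · #{b ∈ E[p^∞] | Gal(ℚ̄/ℚ_n)·b = b}²` when `X` is torsion without
non-zero finite submodules (FILE 5 `natCard_quotient_layerIdeal_le_pow`) — X1R0-GAPMAP §14.1's
`t_n + a − 2δ ≤ λ + pⁿμ` with `a = e` supplied by the local package at `wp`.
[cite: GreenbergLNM1716, §3 Lemma 3.1, Lemma 3.4, §5 pp. 114–118, p. 137] -/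
theorem pow_card_add_le_pow_mul_sq_of_strict
    [Module.Finite (IwasawaAlgebra p) D.X] [NumberField (κ.layer n)]
    (hfix : Set.Finite {b : geomPrimaryTorsion W p |
      ∀ τ : Field.absoluteGaloisGroup ℚ, τ ∈ κ.kerSubgroup → τ • b = b})
    (hX : D.IsTorsion) (hnf : ∀ N : Submodule (IwasawaAlgebra p) D.X, Finite N → N = ⊥)
    (hodd : p ≠ 2) (hκ : κ.IsCyclotomic) (hGrK : imKummer_ge_strictCondition_goodOrdinary)
    (v : HeightOneSpectrum (𝓞 ℚ)) (hpv : ((p : ℕ) : 𝓞 ℚ) ∈ v.asIdeal)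
    (hΔ : ¬ (p : ℤ) ∣ minimalDiscriminantInt W) (hord : ¬ (p : ℤ) ∣ W.frobeniusTrace p)
    (inv : LocalInvariants (κ.layer n) p) (hperf : inv.IsPerfect) (hsum : inv.SumLocalTermEqZero)
    (hcompl : inv.SelmerComplement)
    (hEP : ∀ w : HeightOneSpectrum (𝓞 (κ.layer n)),
      localEulerPoincareCharacteristic (w.adicCompletion (κ.layer n)))
    (T₀ : Finset (HeightOneSpectrum (𝓞 (κ.layer n))))
    (hT₀p : ∀ w ∈ T₀, ((p : ℕ) : 𝓞 (κ.layer n)) ∉ w.asIdeal)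
    (hwit : ∀ w ∈ T₀, ∃ u ∈ unramifiedSubgroup
        (((W.baseChange (κ.layer n)).torsionGaloisModule (p : ℤ)).restrictField
          (w.adicCompletion (κ.layer n))) 1,
      u ∉ (W.baseChange (κ.layer n)).kummerLocalConditionAt (p : ℤ) (w.adicCompletion (κ.layer n)))
    (wp : HeightOneSpectrum (𝓞 (κ.layer n))) (hwpT₀ : wp ∉ T₀) (hwpv : wp.asIdeal.LiesOver v.asIdeal)
    (𝓛 : ∀ w : HeightOneSpectrum (𝓞 (κ.layer n)), AddSubgroup (galoisCohomology
      (((W.baseChange (κ.layer n)).torsionGaloisModule (p : ℤ)).toLocal (Sum.inr w)) 1))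
    (h𝓛 : (W.baseChange (κ.layer n)).kummerSelmerStructure (p : ℤ) (Sum.inr wp) ≤ 𝓛 wp) (e : ℕ)
    (hidx : p ^ e * Nat.card ((W.baseChange (κ.layer n)).kummerSelmerStructure (p : ℤ) (Sum.inr wp)) ≤
      Nat.card (𝓛 wp))
    (hstrict : ∀ y : galH1Torsion (W.baseChange (κ.layer n)) (p : ℤ),
      galoisCohomology.localization ((W.baseChange (κ.layer n)).torsionGaloisModule (p : ℤ))
        (Sum.inr wp) 1 y ∈ 𝓛 wp →
      ∃ φ : contOneCocycles (discreteTopRep (Field.absoluteGaloisGroup (κ.layer n))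
        (geomTorsion (W.baseChange (κ.layer n)) (p : ℤ))), oneCocycleClass _ φ = y ∧
        ∀ x : inertiaIn κ.kerSubgroup v,
          localRed W p hpv hΔ (pointsMap W (v.adicCompletion ℚ)
            (((primaryBaseChangeEquiv (κ.layer n) W p).symm
              (AddSubgroup.inclusion (geomTorsion_le_geomPrimaryTorsion (W.baseChange (κ.layer n)) p)
                (φ.1 ((kerOfKer κ n κn hκn (inertiaInToH κ.kerSubgroup v x) : κn.kerSubgroup) :
                  Field.absoluteGaloisGroup (κ.layer n)))) : W.geomPrimaryTorsion p) :
              W.geomPoints)) = 0) :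
    p ^ (T₀.card + e) ≤ p ^ (lambdaInvariant p D.X + p ^ n * muInvariant p D.X) *
      Nat.card {b : geomPrimaryTorsion W p //
        ∀ σ : Field.absoluteGaloisGroup ℚ, σ ∈ κ.layerSubgroup n → σ • b = b} ^ 2 :=
  LayerFixedPointsCount.pow_card_add_le_pow_mul_sq' n κn hκn D hfix hodd hX hnf hκ inv hperf hsum
    hcompl hEP T₀ hT₀p hwit v wp hwpT₀ hwpv 𝓛 h𝓛 e hidx
    (fun y hy σ ↦ by
      obtain ⟨φ, rfl, hφ⟩ := hstrict y hy
      exact conjH1_kerH1Iso_layerToInfty_mem_localKerOver_of_strict W κ n κn hκn hGrK hΔ hord hκ v hpv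
        φ hφ σ)

/-- **ROUTE R1′ at `E(ℚ)[p] = 0`: `#T₀ + e ≤ λ(X) + pⁿ μ(X)`** — FILE 9 §3
(`succ_card_le_lambda_add_pow_mul_mu_of_tamagawaWitnesses_layer_at`, `e = 1`) with the
`ℚ_{n,∞}`-framework hypothesis `hloc` replaced by strictness at `p` over `ℚ_∞` (`hstrict`) and the
index `p^e`. [cite: GreenbergLNM1716, §2 Prop. 2.4, §3 Lemma 3.4, §5 pp. 114–118, p. 137] -/
theorem card_add_le_lambda_add_pow_mul_mu_of_strict
    [Module.Finite (IwasawaAlgebra p) D.X] [NumberField (κ.layer n)]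
    (hX : D.IsTorsion) (hnf : ∀ N : Submodule (IwasawaAlgebra p) D.X, Finite N → N = ⊥)
    (hK : ∀ P : W.toAffine.Point, p • P = 0 → P = 0)
    (hodd : p ≠ 2) (hκ : κ.IsCyclotomic) (hGrK : imKummer_ge_strictCondition_goodOrdinary)
    (v : HeightOneSpectrum (𝓞 ℚ)) (hpv : ((p : ℕ) : 𝓞 ℚ) ∈ v.asIdeal)
    (hΔ : ¬ (p : ℤ) ∣ minimalDiscriminantInt W) (hord : ¬ (p : ℤ) ∣ W.frobeniusTrace p)
    (inv : LocalInvariants (κ.layer n) p) (hperf : inv.IsPerfect) (hsum : inv.SumLocalTermEqZero)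
    (hcompl : inv.SelmerComplement)
    (hEP : ∀ w : HeightOneSpectrum (𝓞 (κ.layer n)),
      localEulerPoincareCharacteristic (w.adicCompletion (κ.layer n)))
    (T₀ : Finset (HeightOneSpectrum (𝓞 (κ.layer n))))
    (hT₀p : ∀ w ∈ T₀, ((p : ℕ) : 𝓞 (κ.layer n)) ∉ w.asIdeal)
    (hwit : ∀ w ∈ T₀, ∃ u ∈ unramifiedSubgroup
        (((W.baseChange (κ.layer n)).torsionGaloisModule (p : ℤ)).restrictField
          (w.adicCompletion (κ.layer n))) 1,
      u ∉ (W.baseChange (κ.layer n)).kummerLocalConditionAt (p : ℤ) (w.adicCompletion (κ.layer n)))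
    (wp : HeightOneSpectrum (𝓞 (κ.layer n))) (hwpT₀ : wp ∉ T₀) (hwpv : wp.asIdeal.LiesOver v.asIdeal)
    (𝓛 : ∀ w : HeightOneSpectrum (𝓞 (κ.layer n)), AddSubgroup (galoisCohomology
      (((W.baseChange (κ.layer n)).torsionGaloisModule (p : ℤ)).toLocal (Sum.inr w)) 1))
    (h𝓛 : (W.baseChange (κ.layer n)).kummerSelmerStructure (p : ℤ) (Sum.inr wp) ≤ 𝓛 wp) (e : ℕ)
    (hidx : p ^ e * Nat.card ((W.baseChange (κ.layer n)).kummerSelmerStructure (p : ℤ) (Sum.inr wp)) ≤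
      Nat.card (𝓛 wp))
    (hstrict : ∀ y : galH1Torsion (W.baseChange (κ.layer n)) (p : ℤ),
      galoisCohomology.localization ((W.baseChange (κ.layer n)).torsionGaloisModule (p : ℤ))
        (Sum.inr wp) 1 y ∈ 𝓛 wp →
      ∃ φ : contOneCocycles (discreteTopRep (Field.absoluteGaloisGroup (κ.layer n))
        (geomTorsion (W.baseChange (κ.layer n)) (p : ℤ))), oneCocycleClass _ φ = y ∧
        ∀ x : inertiaIn κ.kerSubgroup v,
          localRed W p hpv hΔ (pointsMap W (v.adicCompletion ℚ)
            (((primaryBaseChangeEquiv (κ.layer n) W p).symm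
              (AddSubgroup.inclusion (geomTorsion_le_geomPrimaryTorsion (W.baseChange (κ.layer n)) p)
                (φ.1 ((kerOfKer κ n κn hκn (inertiaInToH κ.kerSubgroup v x) : κn.kerSubgroup) :
                  Field.absoluteGaloisGroup (κ.layer n)))) : W.geomPrimaryTorsion p) :
              W.geomPoints)) = 0) :
    T₀.card + e ≤ lambdaInvariant p D.X + p ^ n * muInvariant p D.X :=
  GeneratorCountLayerAtV0.card_add_le_lambda_add_pow_mul_mu n κn hκn D hodd hX hnf
    (fun P hP ↦ hK P (by convert hP)) hκ inv hperf hsum hcompl hEP T₀ hT₀p hwit v wp hwpT₀ hwpv 𝓛 h𝓛 e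
    hidx
    (fun y hy σ ↦ by
      obtain ⟨φ, rfl, hφ⟩ := hstrict y hy
      exact conjH1_kerH1Iso_layerToInfty_mem_localKerOver_of_strict W κ n κn hκn hGrK hΔ hord hκ v hpv
        φ hφ σ)

end Rat

section Ordinary

variable {γ : Field.absoluteGaloisGroup ℚ} (D : W.SelmerDualData κ γ)

/-! ## §3. Good ordinary odd `p`: the finiteness discharged and the loss factor `= #E[p^∞]^{Γ_ℚ}` -/

/-- At a good ordinary odd `p` with `κ` cyclotomic, `{b ∈ E[p^∞] | Gal(ℚ̄/ℚ_∞)·b = b}` is finite — the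
tree's `finite_fixedPoints_kerSubgroup_geomPrimaryTorsion_of_ordinary` (`E(ℚ_∞)[p^∞] = E(ℚ)[p^∞]`,
Mazur/Imai) in the `Set.Finite` form of `hfix`. [cite: GreenbergLNM1716, §1 p. 62, §3 p. 86] -/
theorem finite_setOf_kerSubgroup_smul_eq (hodd : p ≠ 2) (hgood : W.HasGoodReductionAtPrime p)
    (hord : ¬ (p : ℤ) ∣ W.frobeniusTrace p) (hκ : κ.IsCyclotomic) :
    Set.Finite {b : geomPrimaryTorsion W p |
      ∀ τ : Field.absoluteGaloisGroup ℚ, τ ∈ κ.kerSubgroup → τ • b = b} := by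
  haveI := W.finite_fixedPoints_kerSubgroup_geomPrimaryTorsion_of_ordinary κ hodd hgood hord hκ
  refine (Set.finite_coe_iff.mp ‹Finite (FixedPoints.addSubgroup κ.kerSubgroup
    (geomPrimaryTorsion W p))›).subset fun b hb ↦ ?_
  exact (FixedPoints.mem_addSubgroup _ _ _).mpr fun τ ↦ by rw [Subgroup.smul_def]; exact hb τ τ.2

include hκn in
/-- **ROUTE R1′ AT A GOOD ORDINARY ODD `p`, census form**:
`p^{#T₀ + e} ≤ p^{λ(X) + pⁿμ(X)} · (#E[p^∞]^{Γ_ℚ})²` — §2 with the finiteness DISCHARGED and the loss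
factor identified with the rational one (`E[p^∞]^{Gal(ℚ̄/ℚ_n)} = E[p^∞]^{Γ_ℚ}`, the tree's
`natCard_fixedBy_layerSubgroup_eq_of_ordinary`), i.e. X1R0-GAPMAP §14.1's `t_n + a − 2δ ≤ λ + pⁿμ` with
`a = e` and `p^δ = #E(ℚ)[p^∞]` — for the 11 layer-1 classes everything except the local package
(`𝓛`, `h𝓛`, `hidx` with `e = 2`, `hstrict`) at `wp` and the typed published inputs is now supplied.
[cite: GreenbergLNM1716, §2 Prop. 2.4, §3 Lemma 3.1, Lemma 3.4, §4 Lemma 4.3, §5 pp. 114–118, p. 137] -/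
theorem pow_card_add_le_pow_mul_sq_of_strict_of_ordinary
    [Module.Finite (IwasawaAlgebra p) D.X] [NumberField (κ.layer n)]
    (hgood : W.HasGoodReductionAtPrime p)
    (hX : D.IsTorsion) (hnf : ∀ N : Submodule (IwasawaAlgebra p) D.X, Finite N → N = ⊥)
    (hodd : p ≠ 2) (hκ : κ.IsCyclotomic) (hGrK : imKummer_ge_strictCondition_goodOrdinary)
    (v : HeightOneSpectrum (𝓞 ℚ)) (hpv : ((p : ℕ) : 𝓞 ℚ) ∈ v.asIdeal)
    (hΔ : ¬ (p : ℤ) ∣ minimalDiscriminantInt W) (hord : ¬ (p : ℤ) ∣ W.frobeniusTrace p)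
    (inv : LocalInvariants (κ.layer n) p) (hperf : inv.IsPerfect) (hsum : inv.SumLocalTermEqZero)
    (hcompl : inv.SelmerComplement)
    (hEP : ∀ w : HeightOneSpectrum (𝓞 (κ.layer n)),
      localEulerPoincareCharacteristic (w.adicCompletion (κ.layer n)))
    (T₀ : Finset (HeightOneSpectrum (𝓞 (κ.layer n))))
    (hT₀p : ∀ w ∈ T₀, ((p : ℕ) : 𝓞 (κ.layer n)) ∉ w.asIdeal)
    (hwit : ∀ w ∈ T₀, ∃ u ∈ unramifiedSubgroup
        (((W.baseChange (κ.layer n)).torsionGaloisModule (p : ℤ)).restrictField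
          (w.adicCompletion (κ.layer n))) 1,
      u ∉ (W.baseChange (κ.layer n)).kummerLocalConditionAt (p : ℤ) (w.adicCompletion (κ.layer n)))
    (wp : HeightOneSpectrum (𝓞 (κ.layer n))) (hwpT₀ : wp ∉ T₀) (hwpv : wp.asIdeal.LiesOver v.asIdeal)
    (𝓛 : ∀ w : HeightOneSpectrum (𝓞 (κ.layer n)), AddSubgroup (galoisCohomology
      (((W.baseChange (κ.layer n)).torsionGaloisModule (p : ℤ)).toLocal (Sum.inr w)) 1))
    (h𝓛 : (W.baseChange (κ.layer n)).kummerSelmerStructure (p : ℤ) (Sum.inr wp) ≤ 𝓛 wp) (e : ℕ)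
    (hidx : p ^ e * Nat.card ((W.baseChange (κ.layer n)).kummerSelmerStructure (p : ℤ) (Sum.inr wp)) ≤
      Nat.card (𝓛 wp))
    (hstrict : ∀ y : galH1Torsion (W.baseChange (κ.layer n)) (p : ℤ),
      galoisCohomology.localization ((W.baseChange (κ.layer n)).torsionGaloisModule (p : ℤ))
        (Sum.inr wp) 1 y ∈ 𝓛 wp →
      ∃ φ : contOneCocycles (discreteTopRep (Field.absoluteGaloisGroup (κ.layer n))
        (geomTorsion (W.baseChange (κ.layer n)) (p : ℤ))), oneCocycleClass _ φ = y ∧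
        ∀ x : inertiaIn κ.kerSubgroup v,
          localRed W p hpv hΔ (pointsMap W (v.adicCompletion ℚ)
            (((primaryBaseChangeEquiv (κ.layer n) W p).symm
              (AddSubgroup.inclusion (geomTorsion_le_geomPrimaryTorsion (W.baseChange (κ.layer n)) p)
                (φ.1 ((kerOfKer κ n κn hκn (inertiaInToH κ.kerSubgroup v x) : κn.kerSubgroup) :
                  Field.absoluteGaloisGroup (κ.layer n)))) : W.geomPrimaryTorsion p) :
              W.geomPoints)) = 0) :
    p ^ (T₀.card + e) ≤ p ^ (lambdaInvariant p D.X + p ^ n * muInvariant p D.X) *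
      Nat.card (MulAction.fixedPoints (Field.absoluteGaloisGroup ℚ) (geomPrimaryTorsion W p)) ^ 2 := by
  have h := pow_card_add_le_pow_mul_sq_of_strict W κ n κn hκn D
    (finite_setOf_kerSubgroup_smul_eq W κ hodd hgood hord hκ) hX hnf hodd hκ hGrK v hpv hΔ hord inv
    hperf hsum hcompl hEP T₀ hT₀p hwit wp hwpT₀ hwpv 𝓛 h𝓛 e hidx hstrict
  have hcard : Nat.card {b : geomPrimaryTorsion W p //
      ∀ σ : Field.absoluteGaloisGroup ℚ, σ ∈ κ.layerSubgroup n → σ • b = b} =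
      Nat.card (MulAction.fixedPoints (Field.absoluteGaloisGroup ℚ) (geomPrimaryTorsion W p)) := by
    rw [← W.natCard_fixedBy_layerSubgroup_eq_of_ordinary κ hodd hgood hord hκ n]
    exact Nat.card_congr (Equiv.subtypeEquivRight fun _ ↦ Iff.rfl)
  rwa [hcard] at h


end Ordinary

end Summit.BirchSwinnertonDyer.Rank1Residual.X1.GeneratorCountLayerAtPStrict

end
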